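import Mathlib.Analysis.SpecialFunctions.Trigonometric.ArctanDeriv
import Literature.Analysis.Fourier.PoissonKernelCircle
import HarnessLib

/-!
# The Möbius-adapted circle map of the Z3-U twin engine: `Θ_s(y) = 2 arctan(s tan(y/2))` has derivative `P_ρ`, `ρ = (s−1)/(s+1)`

MODEL-side kernel companion of the ns-blowup profile programme (zone Z3, case Z3-U TWIN, engine «u5t», seat ns-blowup-profile-eng-5 g8;
HOME/profile/z3twin/PREREG-U-TWIN.md §1). The second, code-disjoint discretisation of the 1-D gCLM model on `𝕋` represents
`ω` through the change of variables `x = x_c + Θ_s⁻¹(θ)`, i.e. `θ = Θ_s(x − x_c)` with `Θ_s(y) = 2 arctan(s tan(y/2))` (`s > 0`), the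
boundary correspondence of the disc automorphism fixing `±1`. The engine uses the EXACT facts

* `Θ_s′(y) = 2s/((1 + s²) + (1 − s²) cos y)` (`hasDerivAt_moebiusAngle`), and
* `Θ_s′ = P_ρ` with `ρ = (s − 1)/(s + 1)`, the Poisson kernel of `Literature.Analysis.Fourier.PoissonKernelCircle`
  (`moebiusAngle_deriv_eq_poissonKernelCircle`, `hasDerivAt_moebiusAngle_poissonKernel`),

which together with `H P_ρ = Q_ρ` (`Literature.Analysis.Fourier.hilbertTransformCircle_poissonKernelCircle`) give the constant in the
engine's Hilbert-transform identity `(Hω)∘X = H_θ(ω∘X) + (2π)⁻¹∫ (Hω) P_ρ = H_θ(ω∘X) − (2π)⁻¹∫ ω Q_ρ`. The conformal covariance of the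
conjugate function itself is NOT proved here. WHAT THIS IS NOT: not NS — calculus facts about a change of variables used by a numerical
engine for a 1-D MODEL.
-/

namespace Summit.NavierStokesRegularity.OSWSelfSimilar.MoebiusAdaptedCircleMap

open Literature.Analysis.Fourier

/-- The **Möbius angle map** `Θ_s(y) = 2 arctan(s tan(y/2))`: for `s > 0` the boundary correspondence (on `(−π, π)`) of the disc
automorphism fixing `±1` that rescales `tan(y/2)` by `s`. [folklore] -/
noncomputable def moebiusAngle (s y : ℝ) : ℝ :=
  2 * Real.arctan (s * Real.tan (y / 2))

/-- For `s > 0` the parameter `ρ = (s − 1)/(s + 1)` satisfies `|ρ| < 1`. [folklore] -/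
theorem abs_moebius_rho_lt_one {s : ℝ} (hs : 0 < s) : |(s - 1) / (s + 1)| < 1 := by
  rw [abs_div, abs_of_pos (by positivity : (0 : ℝ) < s + 1), div_lt_one (by positivity)]
  rcases le_or_gt 1 s with h | h
  · rw [abs_of_nonneg (by linarith)]; linarith
  · rw [abs_of_neg (by linarith)]; linarith

/-- The map denominator is positive: `(1 + s²) + (1 − s²) cos y = (1 + cos y) + s²(1 − cos y) > 0` for `s > 0`. [folklore] -/
theorem moebiusDenom_pos {s : ℝ} (hs : 0 < s) (y : ℝ) : 0 < (1 + s ^ 2) + (1 - s ^ 2) * Real.cos y := by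
  have hc1 : Real.cos y ≤ 1 := Real.cos_le_one y
  have hc2 : -1 ≤ Real.cos y := Real.neg_one_le_cos y
  have hs2 : 0 < s ^ 2 := by positivity
  rcases le_total s 1 with h | h
  · have h' : s ^ 2 ≤ 1 := by nlinarith
    nlinarith [mul_nonneg (sub_nonneg.mpr h') (by linarith : (0 : ℝ) ≤ Real.cos y + 1)]
  · have h' : 1 ≤ s ^ 2 := by nlinarith
    nlinarith [mul_nonneg (sub_nonneg.mpr h') (by linarith : (0 : ℝ) ≤ 1 - Real.cos y)]

/-- Derivative of the Möbius angle map in half-angle form: `Θ_s′(y) = s/(cos²(y/2) + s² sin²(y/2))` wherever `cos(y/2) ≠ 0`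
(chain rule through `arctan`, `s·`, `sin/cos`, `·/2`). [folklore] -/
theorem hasDerivAt_moebiusAngle_half {s y : ℝ} (hy : Real.cos (y / 2) ≠ 0) :
    HasDerivAt (moebiusAngle s) (s / (Real.cos (y / 2) ^ 2 + s ^ 2 * Real.sin (y / 2) ^ 2)) y := by
  have e : moebiusAngle s = fun t => 2 * Real.arctan (s * (Real.sin (t / 2) / Real.cos (t / 2))) := by
    funext t
    simp [moebiusAngle, Real.tan_eq_sin_div_cos]
  rw [e]
  have h1 : HasDerivAt (fun t : ℝ => t / 2) (1 / 2) y := by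
    simpa using (hasDerivAt_id y).div_const 2
  have hsin : HasDerivAt (fun t : ℝ => Real.sin (t / 2)) (Real.cos (y / 2) * (1 / 2)) y := h1.sin
  have hcos : HasDerivAt (fun t : ℝ => Real.cos (t / 2)) (-Real.sin (y / 2) * (1 / 2)) y := h1.cos
  have hq : HasDerivAt (fun t : ℝ => Real.sin (t / 2) / Real.cos (t / 2))
      ((Real.cos (y / 2) * (1 / 2) * Real.cos (y / 2) - Real.sin (y / 2) * (-Real.sin (y / 2) * (1 / 2))) /
        Real.cos (y / 2) ^ 2) y := hsin.div hcos hy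
  have hm : HasDerivAt (fun t : ℝ => s * (Real.sin (t / 2) / Real.cos (t / 2)))
      (s * ((Real.cos (y / 2) * (1 / 2) * Real.cos (y / 2) - Real.sin (y / 2) * (-Real.sin (y / 2) * (1 / 2))) /
        Real.cos (y / 2) ^ 2)) y := hq.const_mul s
  have ha : HasDerivAt (fun t : ℝ => Real.arctan (s * (Real.sin (t / 2) / Real.cos (t / 2))))
      (1 / (1 + (s * (Real.sin (y / 2) / Real.cos (y / 2))) ^ 2) *
        (s * ((Real.cos (y / 2) * (1 / 2) * Real.cos (y / 2) - Real.sin (y / 2) * (-Real.sin (y / 2) * (1 / 2))) /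
          Real.cos (y / 2) ^ 2))) y := hm.arctan
  have h5 : HasDerivAt (fun t : ℝ => 2 * Real.arctan (s * (Real.sin (t / 2) / Real.cos (t / 2))))
      (2 * (1 / (1 + (s * (Real.sin (y / 2) / Real.cos (y / 2))) ^ 2) *
        (s * ((Real.cos (y / 2) * (1 / 2) * Real.cos (y / 2) - Real.sin (y / 2) * (-Real.sin (y / 2) * (1 / 2))) /
          Real.cos (y / 2) ^ 2)))) y := ha.const_mul 2
  refine h5.congr_deriv ?_
  have hcσ : Real.sin (y / 2) ^ 2 + Real.cos (y / 2) ^ 2 = 1 := Real.sin_sq_add_cos_sq _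
  have hnum : Real.cos (y / 2) * (1 / 2) * Real.cos (y / 2) - Real.sin (y / 2) * (-Real.sin (y / 2) * (1 / 2)) = 1 / 2 := by
    linear_combination (1 / 2 : ℝ) * hcσ
  rw [hnum]
  field_simp

/-- Derivative of the Möbius angle map: `Θ_s′(y) = 2s/((1 + s²) + (1 − s²) cos y)` wherever `cos(y/2) ≠ 0` (`s > 0`).
[folklore] -/
theorem hasDerivAt_moebiusAngle {s y : ℝ} (hs : 0 < s) (hy : Real.cos (y / 2) ≠ 0) :
    HasDerivAt (moebiusAngle s) (2 * s / ((1 + s ^ 2) + (1 - s ^ 2) * Real.cos y)) y := by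
  have h := hasDerivAt_moebiusAngle_half (s := s) hy
  have hc2 : Real.cos y = 2 * Real.cos (y / 2) ^ 2 - 1 := by
    have := Real.cos_two_mul (y / 2)
    rwa [show 2 * (y / 2) = y by ring] at this
  have hcσ : Real.sin (y / 2) ^ 2 + Real.cos (y / 2) ^ 2 = 1 := Real.sin_sq_add_cos_sq _
  have hden : (1 + s ^ 2) + (1 - s ^ 2) * Real.cos y = 2 * (Real.cos (y / 2) ^ 2 + s ^ 2 * Real.sin (y / 2) ^ 2) := by
    rw [hc2]; linear_combination (-(2 : ℝ) * s ^ 2) * hcσ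
  have hpos : 0 < Real.cos (y / 2) ^ 2 + s ^ 2 * Real.sin (y / 2) ^ 2 := by
    have : 0 < Real.cos (y / 2) ^ 2 := by positivity
    nlinarith [sq_nonneg (s * Real.sin (y / 2))]
  refine h.congr_deriv ?_
  rw [hden]
  field_simp

/-- The derivative of the Möbius angle map IS the Poisson kernel: `2s/((1 + s²) + (1 − s²) cos y) = P_ρ(y)` with
`ρ = (s − 1)/(s + 1)` (`s > 0`), i.e. `dΘ_s/dy = P_ρ`, which is what makes `Θ_s` push the uniform measure `dθ/2π` forward to the
harmonic measure of the disc automorphism. [folklore] -/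
theorem moebiusAngle_deriv_eq_poissonKernelCircle {s : ℝ} (hs : 0 < s) (y : ℝ) :
    2 * s / ((1 + s ^ 2) + (1 - s ^ 2) * Real.cos y) = poissonKernelCircle ((s - 1) / (s + 1)) y := by
  unfold poissonKernelCircle
  have h1 : (s + 1) ≠ 0 := by positivity
  have hden : (1 + s ^ 2) + (1 - s ^ 2) * Real.cos y ≠ 0 := ne_of_gt (moebiusDenom_pos hs y)
  have hD : 1 - 2 * ((s - 1) / (s + 1)) * Real.cos y + ((s - 1) / (s + 1)) ^ 2 ≠ 0 :=
    ne_of_gt (poissonDenom_pos (abs_moebius_rho_lt_one hs) y)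
  rw [div_eq_div_iff hden hD]
  field_simp
  ring

/-- Corollary: for `s > 0` and `cos(y/2) ≠ 0`, `HasDerivAt (moebiusAngle s) (P_ρ(y)) y` with `ρ = (s−1)/(s+1)`. [folklore] -/
theorem hasDerivAt_moebiusAngle_poissonKernel {s y : ℝ} (hs : 0 < s) (hy : Real.cos (y / 2) ≠ 0) :
    HasDerivAt (moebiusAngle s) (poissonKernelCircle ((s - 1) / (s + 1)) y) y := by
  rw [← moebiusAngle_deriv_eq_poissonKernelCircle hs y]
  exact hasDerivAt_moebiusAngle hs hy

end Summit.NavierStokesRegularity.OSWSelfSimilar.MoebiusAdaptedCircleMap
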